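import Summits.AtomisticToContinuum.Crystallization.Theorems.HullExactificationCascadeHullGoodEverywhereGoodAPI
import Summits.AtomisticToContinuum.Crystallization.Theorems.HullExactificationCascadeHullExactShellsLimits

/-!
# Crux `DisclinationRation.HullGlue` (stmt-AtomisticToContinuum-15802), line `birth` —
# stub 1 `stub_cleanCores`: clean cores, recentred

Step 1 of the second hull exactification.  Let `S ⊆ ℝ³` be a `δ`-separated (`δ > 0`),
relatively dense (`R₁`-dense) hull element of the fixed family `x` of finite configurations (a
two-way local limit of translates of `x (φ j)`), and suppose the points of `S` that are not
`SiteGood` (first shell `1/20`-matched, after rescaling by the local scale, to an isometric copy of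
the fcc or the hcp kissing pattern) have density zero uniformly on balls.  Then for every `n : ℕ`
there is a set `X n ⊆ ℝ³` which is `δ`-separated, contains `0`, is again a hull element of `x`, is
`R₁`-dense (ONE radius for all `n`), and all of whose points of norm `≤ n` are `SiteGood` in `X n`.

Proof (`stub_cleanCores`, verbatim Steps 1–2 of `hullExactShells_proof`): a defect-free open ball
of radius `n + R₁ + 1` (`HullExactShells.exists_ball_forall_not`, grid/pigeonhole from the zero
density at the centre `0`) contains, by `R₁`-denseness, a point `y_n ∈ S` all of whose
`S`-neighbours within `n` are good; the recentred set `X n := (· + y_n) ⁻¹' S = S - y_n ∋ 0`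
inherits separation (`sep_preimage_add_const`), hull-ness (`isLimit_preimage_add_const`),
`R₁`-denseness (translate the witness) and goodness on the core `‖z‖ ≤ n`
(`SiteGood.translate` with the vector `-y_n`, `Set.image_add_right'`).  All `[folklore]`
(Radin 1991 §2–3; Baake–Grimm 2013, Remark 5.6, local rubber topology).
-/

noncomputable section

namespace Summit.AtomisticToContinuum.Crystallization.Theorems.DisclinationRationHullGlue

open Filter Topology Metric Set
open Literature.MathematicalPhysics.StatisticalMechanics
open Summit.AtomisticToContinuum.Crystallization.Theorems
open Summit.AtomisticToContinuum.Crystallization.Theorems.HullExactShells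

/-- **Stub 1 of line `birth` (crux `HullGlue`, stmt-AtomisticToContinuum-15802): clean cores,
recentred.**  A `δ`-separated (`δ > 0`), relatively dense hull element `S` of the family `x` whose
non-`SiteGood` points have density zero uniformly on balls yields sets `X n` (`n : ℕ`) and one
radius `R₁` such that every `X n` is `δ`-separated, contains `0`, is a hull element of `x`, is
`R₁`-dense, and every point of `X n` of norm `≤ n` is `SiteGood` in `X n` (`X n := S - y_n` for a
point `y_n ∈ S` in a defect-free ball of radius `n + R₁ + 1`). [folklore] -/
theorem stub_cleanCores : ∀ (x : (N : ℕ) → (Fin N → EuclideanSpace ℝ (Fin 3))) (S : Set (EuclideanSpace ℝ (Fin 3))) (δ : ℝ), 0 < δ → (∀ y ∈ S, ∀ z ∈ S, y ≠ z → δ ≤ dist y z) → (∃ φ : ℕ → ℕ, StrictMono φ ∧ ∃ τ : ℕ → EuclideanSpace ℝ (Fin 3), ∀ R ε : ℝ, 0 < ε → ∀ᶠ j : ℕ in Filter.atTop, (∀ s ∈ S, ‖s‖ ≤ R → ∃ i : Fin (φ j), dist (x (φ j) i + τ j) s ≤ ε) ∧ (∀ i : Fin (φ j), ‖x (φ j)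 i + τ j‖ ≤ R → ∃ s ∈ S, dist (x (φ j) i + τ j) s ≤ ε)) → (∃ R₁ : ℝ, ∀ p : EuclideanSpace ℝ (Fin 3), ∃ y ∈ S, dist y p ≤ R₁) → (∀ θ : ℝ, 0 < θ → ∃ L₀ : ℝ, ∀ L : ℝ, L₀ ≤ L → ∀ c : EuclideanSpace ℝ (Fin 3), (({y : EuclideanSpace ℝ (Fin 3) | y ∈ S ∧ dist y c ≤ L ∧ ¬ Summit.AtomisticToContinuum.Crystallization.Theorems.SiteGood S y} : Set (EuclideanSpace ℝ (Fin 3))).ncard : ℝ) ≤ θ * L ^ 3) → ∃ X : ℕ → Set (EuclideanSpace ℝ (Fin 3)), ∃ R₁ : ℝ, ∀ n : ℕ, (∀ y ∈ X n, ∀ z ∈ X n, y ≠ z → δ ≤ dist y z) ∧ (0 : EuclideanSpace ℝ (Fin 3)) ∈ X n ∧ (∃ φ : ℕ → ℕ, StrictMono φ ∧ ∃ τ : ℕ → EuclideanSpace ℝ (Fin 3), ∀ R ε : ℝ, 0 < ε → ∀ᶠ j : ℕ in Filter.atTop, (∀ s ∈ X n, ‖s‖ ≤ R → ∃ i : Fin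 (φ j), dist (x (φ j) i + τ j) s ≤ ε) ∧ (∀ i : Fin (φ j), ‖x (φ j) i + τ j‖ ≤ R → ∃ s ∈ X n, dist (x (φ j) i + τ j) s ≤ ε)) ∧ (∀ p : EuclideanSpace ℝ (Fin 3), ∃ y ∈ X n, dist y p ≤ R₁) ∧ (∀ z ∈ X n, ‖z‖ ≤ (n : ℝ) → Summit.AtomisticToContinuum.Crystallization.Theorems.SiteGood (X n) z) := by
  intro x S δ hδ hsep hHL hdense hdens
  classical
  obtain ⟨R₁, hR₁⟩ := hdense
  have hR₁0 : 0 ≤ R₁ := by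
    obtain ⟨y, -, hy⟩ := hR₁ 0
    exact dist_nonneg.trans hy
  -- Step 1: for every `n` a centre `y_n ∈ S` all of whose `S`-neighbours within `n` are good
  have hA : ∀ n : ℕ, ∃ y ∈ S, ∀ z ∈ S, dist z y ≤ n → SiteGood S z := by
    intro n
    obtain ⟨c, hc⟩ := exists_ball_forall_not hδ hsep (bad := fun z => ¬ SiteGood S z)
      (fun θ hθ => (hdens θ hθ).imp fun L₀ hL₀ L hL => hL₀ L hL 0)
      (r := n + R₁ + 1) (by have := Nat.cast_nonneg (α := ℝ) n; linarith)
    obtain ⟨y, hyS, hyc⟩ := hR₁ c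
    refine ⟨y, hyS, fun z hz hzy => not_not.1 (hc z hz ?_)⟩
    linarith [dist_triangle z y c]
  choose yc hycS hgood using hA
  -- Step 2: recentre, `X n := S - yc n = (· + yc n) ⁻¹' S ∋ 0`
  obtain ⟨Xs, hXs⟩ : ∃ Xs : ℕ → Set (EuclideanSpace ℝ (Fin 3)),
      ∀ n, Xs n = (fun p => p + yc n) ⁻¹' S := ⟨_, fun n => rfl⟩
  refine ⟨Xs, R₁, fun n => ⟨?_, ?_, ?_, ?_, ?_⟩⟩
  · -- separation
    rw [hXs n]; exact sep_preimage_add_const hsep (yc n)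
  · -- the root
    rw [hXs n]
    show (0 : EuclideanSpace ℝ (Fin 3)) + yc n ∈ S
    rw [zero_add]; exact hycS n
  · -- hull element
    rw [hXs n]; exact isLimit_preimage_add_const hHL (yc n)
  · -- `R₁`-dense
    intro p
    obtain ⟨y', hy'S, hy'⟩ := hR₁ (p + yc n)
    refine ⟨y' - yc n, ?_, ?_⟩
    · rw [hXs n]
      show y' - yc n + yc n ∈ S
      rw [sub_add_cancel]; exact hy'S
    · rwa [← dist_add_right (y' - yc n) p (yc n), sub_add_cancel]
  · -- goodness on the core `‖z‖ ≤ n`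
    intro z hz hzn
    rw [hXs n] at hz ⊢
    have hzS : z + yc n ∈ S := hz
    have hzd : dist (z + yc n) (yc n) ≤ n := by
      rw [dist_eq_norm, add_sub_cancel_right]; exact hzn
    have ht := (hgood n (z + yc n) hzS hzd).translate hδ hsep hzS (-(yc n))
    rw [add_neg_cancel_right, Set.image_add_right'] at ht
    exact ht

end Summit.AtomisticToContinuum.Crystallization.Theorems.DisclinationRationHullGlue

end
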